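import Literature.Combinatorics.SimpleGraph.KYPairBlock
import Literature.Combinatorics.SimpleGraph.KYAdjToSeidel
import Literature.Combinatorics.SimpleGraph.KYShapeIdentities
import Literature.Combinatorics.SimpleGraph.KYSeidelToolkit
import HarnessLib

/-!
# Kunisky–Yu §3.6: a lower bound for the pair block `F = ¼ vᵀH^{2,2}v`

Continuation of `KYPairBlock.lean` (Kunisky–Yu 2022, arXiv:2211.02713, (54), (59)–(65)). For a
conference Seidel matrix (`hS`, `S² = qI − J`) and a symmetric zero-diagonal `Vm`, the exact
expansion
`F = −(α₂²/4)σ₀² + (α₂/2)N₂ + α₃ tr(VmAVm) + (α₄/4)Q₄` (`pairBlock_eq`) is combined with the passage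
`A → S` (`KYAdjToSeidel.lean`), the shape identities (`KYShapeIdentities.lean`) and the elementary norm
bounds (`KYSeidelToolkit.lean`) into

* `pairBlock_ge` — for `α₃, α₄ ≥ 0`, any `θ > 0`, and any `K` with `|Θ(Vm)| ≤ K N₂`
  (`Θ = Σ Vm_{ab}Vm_{cd}S_{ac}S_{ad}S_{bc}S_{bd}`, the `T^{4,4,1}` form — the ONLY non-elementary
  input,
  KY Theorem 3.35):
  `F ≥ (α₄/64 − α₂²/4) σ₀² + (α₂/2 − α₃/2 + α₄/32 − (α₃/2)√q − (α₄/64)(2q²/θ + 66q + K)) N₂`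
  `    + (α₃/2 − α₄/16 − (α₄/64)(4√q + 2θ)) G₂`.

This is KY (59)–(63) with explicit constants: the three "budgets" `V₀, V₁, V₂` are the coefficients
of
`σ₀² = (𝟙ᵀVm𝟙)²`, `G₂ = ‖Vm𝟙‖²`, `N₂ = ‖Vm‖_F²`.

## References

* [KuniskyYu2022] D. Kunisky, X. Yu, arXiv:2211.02713, (54), (59)–(65), Theorem 3.35.
-/

noncomputable section

namespace Literature.Combinatorics.SimpleGraph

open Matrix Finset

section PairBlockBound

variable {V : Type*} [Fintype V] [DecidableEq V] (G : _root_.SimpleGraph V) [DecidableRel G.Adj]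

omit [DecidableEq V] in
/-- Pointwise AM–GM for the shape `Σ_a g_a ℓ_a`: `|Σ_a g_a ℓ_a| ≤ (θ/2) Σ g² + (1/(2θ)) Σ ℓ²`.
[folklore] -/
theorem abs_sum_mul_le_amgm (g l : V → ℝ) {θ : ℝ} (hθ : 0 < θ) :
    |∑ a, g a * l a| ≤ θ / 2 * ∑ a, g a ^ 2 + 1 / (2 * θ) * ∑ a, l a ^ 2 := by
  rw [Finset.mul_sum, Finset.mul_sum, ← Finset.sum_add_distrib]
  refine (Finset.abs_sum_le_sum_abs _ _).trans (Finset.sum_le_sum fun a _ => ?_)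
  rw [abs_le]
  have hθ' : 0 < 1 / (2 * θ) := by positivity
  constructor
  · have h : 0 ≤ θ / 2 * (g a + l a / θ) ^ 2 := by positivity
    have e : θ / 2 * (g a + l a / θ) ^ 2 = θ / 2 * g a ^ 2 + 1 / (2 * θ) * l a ^ 2 + g a * l a := by
      field_simp; ring
    linarith
  · have h : 0 ≤ θ / 2 * (g a - l a / θ) ^ 2 := by positivity
    have e : θ / 2 * (g a - l a / θ) ^ 2 = θ / 2 * g a ^ 2 + 1 / (2 * θ) * l a ^ 2 - g a * l a := by
      field_simp; ring
    linarith

/-- **Lower bound for the pair block** (KY (59)–(63) with explicit constants). For the Seidel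
matrix of a
conference graph (`S𝟙 = 0` is not needed here; `S² = qI − J`), levels with `α₃, α₄ ≥ 0`, a symmetric
zero-diagonal `Vm`, any `θ > 0` and any `K` bounding the `T^{4,4,1}` form `Θ(Vm)`:
`¼ Σ Vm_{ab}Vm_{cd}H({a,b},{c,d}) ≥ (α₄/64 − α₂²/4)σ₀²`
` + (α₂/2 − α₃/2 + α₄/32 − (α₃/2)√q − (α₄/64)(2q²/θ + 66q + K)) N₂ + (α₃/2 − α₄/16 − (α₄/64)(4√q + 2θ)) G₂`.
[cite: KuniskyYu2022, (59)–(63)] -/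
theorem pairBlock_ge {S : Matrix V V ℝ}
    (hS : ∀ a b, S a b = if a = b then 0 else if G.Adj a b then 1 else -1)
    (hsq : S * S = (Fintype.card V : ℝ) • (1 : Matrix V V ℝ) - of fun _ _ => 1)
    (α : ℕ → ℝ) (hα3 : 0 ≤ α 3) (hα4 : 0 ≤ α 4)
    (Vm : Matrix V V ℝ) (hVt : Vmᵀ = Vm) (hVd : ∀ x, Vm x x = 0)
    {θ K : ℝ} (hθ : 0 < θ)
    (hΘ : |∑ a, ∑ b, ∑ c, ∑ d, Vm a b * Vm c d * (S a c * S a d * S b c * S b d)| ≤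
      K * ∑ a, ∑ b, Vm a b ^ 2) :
    (α 4 / 64 - α 2 ^ 2 / 4) * (∑ a, ∑ b, Vm a b) ^ 2 +
      (α 2 / 2 - α 3 / 2 + α 4 / 32 - α 3 / 2 * Real.sqrt (Fintype.card V) -
        α 4 / 64 * (2 * (Fintype.card V : ℝ) ^ 2 / θ + 66 * Fintype.card V + K)) *
        ∑ a, ∑ b, Vm a b ^ 2 +
      (α 3 / 2 - α 4 / 16 - α 4 / 64 * (4 * Real.sqrt (Fintype.card V) + 2 * θ)) *
        ∑ a, (∑ b, Vm a b) ^ 2 ≤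
      (1 / 4) * ∑ a, ∑ b, ∑ c, ∑ d, Vm a b * Vm c d * kyEntry G α {a, b} {c, d} := by
  have hVs : ∀ x y, Vm x y = Vm y x := fun x y => by
    have h := congrFun (congrFun hVt x) y
    rw [transpose_apply] at h
    exact h.symm
  have hSs : ∀ x y, S x y = S y x := by
    intro x y; rw [hS, hS]
    by_cases h : x = y
    · subst h; rfl
    · rw [if_neg h, if_neg (Ne.symm h)]
      by_cases hadj : G.Adj x y
      · rw [if_pos hadj, if_pos hadj.symm]
      · rw [if_neg hadj, if_neg (fun h' => hadj h'.symm)]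
  have hSb : ∀ x y, |S x y| ≤ 1 := fun x y => by rw [hS]; split_ifs <;> simp
  -- (1) the exact identities
  have hF0 := pairBlock_eq G α Vm hVt hVd
  have hTA := sum_adj_sandwich_eq G hS Vm hVs
  have hQ4 := sum_adj_prod_eq G hS Vm hVs hVd
  have hRall_eq := sum_prod_sub_one_eq S Vm hSs hVs
  have hcorr := (abs_le.1 (abs_sub_le_of_coincidence hSb Vm hVs)).1
  -- (2) the elementary bounds (lower halves)
  have hgSg := (abs_le.1 (abs_seidel_quad_le hSs hsq (fun a => ∑ b, Vm a b))).1
  have hl2 := sum_sq_diag_SVS_le hSs hsq Vm hVs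
  have hgl := (abs_le.1 (abs_sum_mul_le_amgm (fun a => ∑ b, Vm a b)
    (fun a => ∑ c, ∑ d, S a c * Vm c d * S d a) hθ)).1
  have htr := (abs_le.1 (abs_trVSVS_le hSs hsq Vm hVs)).1
  have hρ := (abs_le.1 (abs_rho_le hSs hSb hsq Vm hVs)).1
  have hΘ' := (abs_le.1 hΘ).1
  have hT3 := (abs_le.1 (abs_sandwich_le hSs hsq Vm hVs)).1
  rw [hF0, hTA, hQ4]
  -- (3) abbreviate
  set q : ℝ := (Fintype.card V : ℝ) with hq
  set N2 : ℝ := ∑ a, ∑ b, Vm a b ^ 2 with hN2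
  set G2 : ℝ := ∑ a, (∑ b, Vm a b) ^ 2 with hG2
  set σ : ℝ := ∑ a, ∑ b, Vm a b with hσ
  set T3 : ℝ := ∑ a, ∑ b, ∑ d, Vm a b * S b d * Vm d a with hT3d
  set Rdis : ℝ := ∑ a, ∑ b, ∑ c, ∑ d, Vm a b * Vm c d *
    (((if a = c then 0 else 1) * (if a = d then 0 else 1) * (if b = c then 0 else 1) *
      (if b = d then 0 else (1 : ℝ))) *
      ((1 + S a c) * (1 + S a d) * (1 + S b c) * (1 + S b d) - 1)) with hRdis
  set Rall : ℝ := ∑ a, ∑ b, ∑ c, ∑ d, Vm a b * Vm c d *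
    ((1 + S a c) * (1 + S a d) * (1 + S b c) * (1 + S b d) - 1) with hRall
  set gSg : ℝ := ∑ a, ∑ c, (∑ b, Vm a b) * S a c * (∑ d, Vm c d) with hgSgd
  set gl : ℝ := ∑ a, (∑ b, Vm a b) * (∑ c, ∑ d, S a c * Vm c d * S d a) with hgld
  set L2 : ℝ := ∑ a, (∑ c, ∑ d, S a c * Vm c d * S d a) ^ 2 with hL2
  set tr : ℝ := ∑ a, ∑ b, ∑ c, ∑ d, Vm a b * S b c * Vm c d * S d a with htrd
  set ρ : ℝ := ∑ a, ∑ c, S a c * (∑ b, Vm a b * S b c) * (∑ d, S a d * Vm d c) with hρd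
  set Θ : ℝ := ∑ a, ∑ b, ∑ c, ∑ d, Vm a b * Vm c d * (S a c * S a d * S b c * S b d) with hΘd
  have hN2 : 0 ≤ N2 := Finset.sum_nonneg fun a _ => Finset.sum_nonneg fun b _ => sq_nonneg _
  have hG2 : 0 ≤ G2 := Finset.sum_nonneg fun a _ => sq_nonneg _
  have hq0 : 0 ≤ q := Nat.cast_nonneg _
  -- (4) the nonnegative pieces
  have hgl2 : gl + θ / 2 * G2 + q ^ 2 / (2 * θ) * N2 ≥ 0 := by
    have h2 : 1 / (2 * θ) * L2 ≤ 1 / (2 * θ) * (q ^ 2 * N2) :=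
      mul_le_mul_of_nonneg_left hl2 (by positivity)
    have e : 1 / (2 * θ) * (q ^ 2 * N2) = q ^ 2 / (2 * θ) * N2 := by ring
    linarith
  have P : 0 ≤ α 3 / 2 * (T3 + Real.sqrt q * N2) +
      α 4 / 64 * ((Rdis - Rall + 60 * q * N2) + 4 * (gSg + Real.sqrt q * G2) +
        4 * (gl + θ / 2 * G2 + q ^ 2 / (2 * θ) * N2) + 2 * (tr + q * N2) + 4 * (ρ + q * N2) +
        (Θ + K * N2)) := by
    have a3 : 0 ≤ α 3 / 2 := by positivity
    have a4 : 0 ≤ α 4 / 64 := by positivity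
    have b1 : 0 ≤ T3 + Real.sqrt q * N2 := by linarith
    have b2 : 0 ≤ (Rdis - Rall + 60 * q * N2) + 4 * (gSg + Real.sqrt q * G2) +
        4 * (gl + θ / 2 * G2 + q ^ 2 / (2 * θ) * N2) + 2 * (tr + q * N2) + 4 * (ρ + q * N2) +
        (Θ + K * N2) := by linarith
    exact add_nonneg (mul_nonneg a3 b1) (mul_nonneg a4 b2)
  -- (5) the algebra
  have key : -(α 2 ^ 2 / 4) * σ ^ 2 + α 2 / 2 * N2 + α 3 * (1 / 2 * (G2 + T3 - N2)) +
      α 4 / 4 * ((σ ^ 2 - 4 * G2 + 2 * N2) / 16 + 1 / 16 * Rdis) -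
      ((α 4 / 64 - α 2 ^ 2 / 4) * σ ^ 2 +
        (α 2 / 2 - α 3 / 2 + α 4 / 32 - α 3 / 2 * Real.sqrt q -
          α 4 / 64 * (2 * q ^ 2 / θ + 66 * q + K)) * N2 +
        (α 3 / 2 - α 4 / 16 - α 4 / 64 * (4 * Real.sqrt q + 2 * θ)) * G2) =
      α 3 / 2 * (T3 + Real.sqrt q * N2) +
      α 4 / 64 * ((Rdis - Rall + 60 * q * N2) + 4 * (gSg + Real.sqrt q * G2) +
        4 * (gl + θ / 2 * G2 + q ^ 2 / (2 * θ) * N2) + 2 * (tr + q * N2) + 4 * (ρ + q * N2) +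
        (Θ + K * N2)) := by
    rw [hRall_eq]
    field_simp
    ring
  linarith [key, P]

end PairBlockBound

end Literature.Combinatorics.SimpleGraph

end
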